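import Summits.CriticalPhenomena.Ising3DConformalLimit.Theorems.MoebiusLimitExists.Negative.FreeTranslations
import Summits.CriticalPhenomena.Ising3DConformalLimit.Theorems.MoebiusLimitExists.Negative.FreePermutations

/-!
# `MoebiusLimit` (item stmt-CriticalPhenomena-1344): coordinate sign-flip invariance of the limit is AUTOMATIC

Structural knowledge about the crux `…Theses.EnergyNotSigmaSquared.MoebiusLimit`
(= `PerfectScreening.MoebiusLimitExists`), standing crux disprover (D-0016); THEOREM-ONLY.

For ANY pointwise scaling limit `S` of the critical correlators on `ℤ³` (any `ρ`, no other
hypothesis) and any linear isometry `R` acting by coordinate sign flips, `(R p)_j = ε_j p_j`: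
`S_n(R ∘ x) = S_n(x)` on non-coincident `x` (`limit_signFlip`). With `FreeTranslations` and
`FreePermutations` this gives invariance of any limit under the full hyperoctahedral group `B₃ ⋉ ℝ³`
of lattice symmetries; the crux's `IsRotationInvariant` thus only asks for the upgrade `B₃ → O(3)`.

Mechanism (the floor does NOT commute with `a ↦ −a`: `⌊−a⌋ = −⌊a⌋ − 1` off the integers): first
translate `x` by a vector `w` making every coordinate irrational (countably many bad values per
coordinate; translations are free, `limit_translate`); along the meshes `1/(k+1)` every flipped
coordinate of every point is then off the grid, so the lattice approximation of `R x'` is the image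
of that of `x'` under the lattice symmetry "flip, then shift by `−1` in the flipped coordinates",
under which the critical state is invariant (`criticalCorr_signedPerm`, `criticalCorr_translate`).
-/

noncomputable section

namespace Summit.CriticalPhenomena.Ising3DConformalLimit.MoebiusLimitExistsNegative

open Literature.Probability.LatticeModels Filter Set
open scoped Topology

variable {ρ : ℝ → ℝ} {S : CorrFamily 3}

/-! ### Floors of sign-flipped irrational multiples -/

/-- `⌊−a⌋ = −⌊a⌋ − 1` for `a` not an integer. [folklore] -/
theorem floor_neg_of_not_int {a : ℝ} (ha : a ∉ Set.range ((↑) : ℤ → ℝ)) : ⌊-a⌋ = -⌊a⌋ - 1 := by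
  rw [Int.floor_neg, (Int.ceil_eq_floor_add_one_iff_notMem a).2 ha]
  ring

/-- Coordinates of an unsigned-trivial signed permutation: `(g_{1,ε} y)_j = ε_j y_j`. [folklore] -/
theorem signedPerm_one_apply (ε : Fin 3 → ℤˣ) (y : Site 3) (j : Fin 3) :
    Site.signedPerm 1 ε y j = (ε j : ℤ) * y j := rfl

/-- The lattice approximation of a sign-flipped point at mesh `1/(k+1)`, when all coordinates are
irrational: flip the approximation and shift by `−1` in the flipped coordinates. [folklore] -/
theorem latticeApprox_signFlip (ε : Fin 3 → ℤˣ)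
    (R : EuclideanSpace ℝ (Fin 3) ≃ₗᵢ[ℝ] EuclideanSpace ℝ (Fin 3))
    (hR : ∀ (p : EuclideanSpace ℝ (Fin 3)) (j : Fin 3), R p j = ((ε j : ℤ) : ℝ) * p j)
    {p : EuclideanSpace ℝ (Fin 3)} (hp : ∀ j, Irrational (p j)) (k : ℕ) :
    latticeApprox (1 / ((k:ℝ) + 1)) (R p) =
      Site.signedPerm 1 ε (latticeApprox (1 / ((k:ℝ) + 1)) p) +
        fun j => if ε j = -1 then -1 else 0 := by
  funext j
  rw [Pi.add_apply, signedPerm_one_apply, latticeApprox_apply, latticeApprox_apply, hR]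
  have hirr : Irrational (p j * ((k + 1 : ℕ) : ℝ)) := (hp j).mul_natCast (Nat.succ_ne_zero k)
  have hdiv : p j / (1 / ((k:ℝ) + 1)) = p j * ((k + 1 : ℕ) : ℝ) := by
    push_cast; field_simp
  rcases Int.units_eq_one_or (ε j) with h | h
  · rw [h, if_neg (by decide), Units.val_one, Int.cast_one, one_mul, one_mul, add_zero]
  · have hnot : p j * ((k + 1 : ℕ) : ℝ) ∉ Set.range ((↑) : ℤ → ℝ) := by
      rintro ⟨m, hm⟩; exact hirr.ne_int m hm.symm
    rw [h, if_pos rfl, Units.val_neg, Units.val_one, Int.cast_neg, Int.cast_one, neg_one_mul,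
      neg_div, hdiv, floor_neg_of_not_int hnot]
    ring

/-! ### Generic configurations: all coordinates irrational -/

/-- For every configuration there is a translation making all coordinates of all points
irrational (each coordinate excludes only countably many shifts). [folklore] -/
theorem exists_translate_irrational {n : ℕ} (x : Fin n → EuclideanSpace ℝ (Fin 3)) :
    ∃ w : EuclideanSpace ℝ (Fin 3), ∀ i j, Irrational ((x i + w) j) := by
  have hcoord : ∀ j : Fin 3, ∃ t : ℝ, ∀ i, Irrational (x i j + t) := by
    intro j
    set B : Set ℝ := ⋃ i : Fin n, Set.range (fun q : ℚ => (q:ℝ) - x i j) with hB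
    have hBc : B.Countable := Set.countable_iUnion fun i => Set.countable_range _
    obtain ⟨t, ht⟩ : ∃ t, t ∉ B := by
      by_contra h
      push Not at h
      exact Set.not_countable_univ (hBc.mono fun t _ => h t)
    refine ⟨t, fun i => ?_⟩
    intro hrat
    apply ht
    rw [hB, Set.mem_iUnion]
    obtain ⟨q, hq⟩ := Set.mem_range.1 hrat
    refine ⟨i, q, ?_⟩
    show (q:ℝ) - x i j = t
    rw [hq]; ring
  choose t ht using hcoord
  refine ⟨WithLp.toLp 2 t, fun i j => ?_⟩
  rw [PiLp.add_apply, PiLp.toLp_apply]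
  exact ht j i

/-! ### Sign-flip invariance of any pointwise limit -/

/-- Sign-flip invariance at a GENERIC configuration (all coordinates irrational), along the
meshes `1/(k+1)`. [folklore] -/
theorem limit_signFlip_of_irrational (hlim : HasPointwiseScalingLimit (criticalCorr 3) ρ S)
    (ε : Fin 3 → ℤˣ) (R : EuclideanSpace ℝ (Fin 3) ≃ₗᵢ[ℝ] EuclideanSpace ℝ (Fin 3))
    (hR : ∀ (p : EuclideanSpace ℝ (Fin 3)) (j : Fin 3), R p j = ((ε j : ℤ) : ℝ) * p j)
    {n : ℕ} {x : Fin n → EuclideanSpace ℝ (Fin 3)} (hx : x ∈ NonCoincident 3 n)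
    (hirr : ∀ i j, Irrational (x i j)) :
    S n (fun i => R (x i)) = S n x := by
  have hRx := (map_mem_nonCoincident_iff R x).2 hx
  have hmesh : Tendsto (fun k : ℕ => (1:ℝ) / ((k:ℝ) + 1)) atTop (𝓝[>] (0:ℝ)) :=
    tendsto_div_succ_nhdsGT one_pos
  have h1 := ((hlim n).tendsto_at hRx).comp hmesh
  have h2 := ((hlim n).tendsto_at hx).comp hmesh
  refine tendsto_nhds_unique h1 (h2.congr fun k => ?_)
  simp only [Function.comp_apply]
  rw [rescaledCorrelator_apply, rescaledCorrelator_apply]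
  congr 1
  have hcfg : (fun i => latticeApprox (1 / ((k:ℝ) + 1)) (R (x i))) =
      fun i => Site.signedPerm 1 ε (latticeApprox (1 / ((k:ℝ) + 1)) (x i)) +
        fun j => if ε j = -1 then -1 else 0 := by
    funext i; exact latticeApprox_signFlip ε R hR (hirr i) k
  rw [hcfg, criticalCorr_translate, criticalCorr_signedPerm]

/-- **Any pointwise scaling limit of the critical correlators on `ℤ³` is invariant under the
coordinate sign flips of `ℝ³`** (as linear isometries `R` with `(R p)_j = ε_j p_j`), on
non-coincident configurations; no hypothesis beyond the limit.
[cite: FriedliVelenik2017, Exercise 3.14, p. 115] -/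
theorem limit_signFlip (hlim : HasPointwiseScalingLimit (criticalCorr 3) ρ S)
    (ε : Fin 3 → ℤˣ) (R : EuclideanSpace ℝ (Fin 3) ≃ₗᵢ[ℝ] EuclideanSpace ℝ (Fin 3))
    (hR : ∀ (p : EuclideanSpace ℝ (Fin 3)) (j : Fin 3), R p j = ((ε j : ℤ) : ℝ) * p j)
    {n : ℕ} {x : Fin n → EuclideanSpace ℝ (Fin 3)} (hx : x ∈ NonCoincident 3 n) :
    S n (fun i => R (x i)) = S n x := by
  obtain ⟨w, hw⟩ := exists_translate_irrational x
  have hxw : (fun i => x i + w) ∈ NonCoincident 3 n := (add_mem_nonCoincident_iff w x).2 hx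
  have hRxw := (map_mem_nonCoincident_iff R (fun i => x i + w)).2 hxw
  -- `R (x i) = R (x i + w) + (-R w)`
  have hcfg : (fun i => R (x i)) = fun i => R (x i + w) + (-R w) := by
    funext i; rw [map_add]; abel
  rw [hcfg, limit_translate hlim (-R w) hRxw, limit_signFlip_of_irrational hlim ε R hR hxw hw,
    limit_translate hlim w hx]

/-- In particular the point reflection `p ↦ −p` leaves any limit invariant on `NonCoincident`.
[cite: FriedliVelenik2017, Exercise 3.14, p. 115] -/
theorem limit_neg (hlim : HasPointwiseScalingLimit (criticalCorr 3) ρ S) {n : ℕ}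
    {x : Fin n → EuclideanSpace ℝ (Fin 3)} (hx : x ∈ NonCoincident 3 n) :
    S n (fun i => -x i) = S n x := by
  have h := limit_signFlip hlim (fun _ => -1) (LinearIsometryEquiv.neg ℝ) (fun p j => by simp) hx
  simpa using h

end Summit.CriticalPhenomena.Ising3DConformalLimit.MoebiusLimitExistsNegative

end
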